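import Mathlib
import Summits.NavierStokesRegularity.NavierStokesRegularity.Theses.SubcriticalEnvelope
import Summits.NavierStokesRegularity.NavierStokesRegularity.Theses.OrthantWake
import Summits.NavierStokesRegularity.NavierStokesRegularity.Theorems.OrthantWakeKPBreakOfBlockWake
import Summits.NavierStokesRegularity.NavierStokesRegularity.Theorems.OrthantWakeOrthantInvariance
import HarnessLib

/-!
# `SubcriticalEnvelope.ForwardSourceTailEnvelopeKP` (stmt-NavierStokesRegularity-27130, crux A⁺_KP)
— OW's KP block ratchet IMPLIES it, AS TYPED (second consolidation edge, glue, `--supports`)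

Critic idea-crit-3 (2026-08-28 09:20:40Z §(C)) named two S-difficulty edges making SE's crux the
weakest of the KP-class statements: `27057 ⇒ 27130` (landed:
`Theorems.forwardSourceTailEnvelopeKP_of_forwardTailCeilingKP`, p622470) and `26999 ⇒ 27130`.
The LEAD of OrthantWake objected (bus, 09:53:34Z (2)) that the second edge «does not type-check as
typed»: in `OrthantWake.KPBlockWake` (26999) the source-complete mode set `S` is chosen AFTER the
viscosity (`∀ ν, ∀ α …, ∃ S, …`), in `ForwardSourceTailEnvelopeKP` (27130) BEFORE it
(`∀ α …, ∃ S, ∀ X₀ ∃ η ∀ T ∃ C ∀ ν`).  This file proves the edge AS TYPED, with no binder repair: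

* take for 27130 the MINIMAL source-complete set, the syntactic forward sources
  `S⁺(α) = {i | ∃ j l, α i j l (0,0,1) ≠ 0}` (chosen from `α` alone);
* for each `ν`, 26999's set `S_ν` is source-complete, hence `S⁺(α) ⊆ S_ν`
  and partial sums of the non-negative shell energies are MONOTONE in the mode set;
* OW's own `forwardBreak_blockEnvelope` (p623971) turns the block ratchet for `T^{S_ν}` (tails
  summable and `≤ E₀` by `orthantBreak_energy_le`, non-negativity by `orthantInvariance_proof`) into
  the `ν`-, window- and horizon-free envelope `E₀(1+ε₀)^{(1+η)(n₁+L)}(1+ε₀)^{-(1+η)n}`,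
  `n₁ = ⌈κ₁/ε₀⌉`, which therefore bounds `T^{S⁺(α)}` with the SAME constant for EVERY `ν`.

Main results: `forwardSourceTailEnvelopeKP_of_kpBlockWake :
OrthantWake.KPBlockWake → SubcriticalEnvelope.ForwardSourceTailEnvelopeKP` and the rung corollary
`subcriticalEnvelope_target_of_kpBlockWake` (through `SubcriticalEnvelope.closes`).

HONEST FRAMING: pure logic + landed bookkeeping about Tao-type MODEL lattice statements (rung
TL-M2Break); both cruxes are OPEN (26999 is PARKED behind 27057, KEY-NS #124); nothing here is a
statement about the Navier–Stokes equations and NS regularity is NOT advanced.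
-/

noncomputable section

-- the sub-problem namespace `NavierStokesRegularity.NavierStokesRegularity` is the tree's layout (D-0017)
set_option linter.dupNamespace false

namespace Summit.NavierStokesRegularity.NavierStokesRegularity.Theorems

open Set
open Literature.Analysis.FluidPDE.TaoCascade
open Summit.NavierStokesRegularity.NavierStokesRegularity.Theses

/-- **OW's KP block ratchet implies SE's KP envelope, AS TYPED (26999 ⇒ 27130).**  Threshold
`εs = ε̄` of the ratchet; mode set `S⁺(α)` (syntactic forward sources, chosen before `ν`); margin
`η` of the ratchet; window constant `E₀(1+ε₀)^{(1+η)(⌈κ₁/ε₀⌉+L)}` (uniform in `T` and `ν`).  For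
each `ν` the ratchet's source-complete set `S_ν ⊇ S⁺(α)` carries the envelope by
`forwardBreak_blockEnvelope`, and `T^{S⁺(α)} ≤ T^{S_ν}`.  Pure logic over landed lemmas.  MODEL
lattice statement. [this file] -/
theorem forwardSourceTailEnvelopeKP_of_kpBlockWake (h : OrthantWake.KPBlockWake) :
    SubcriticalEnvelope.ForwardSourceTailEnvelopeKP := by
  classical
  intro R hR
  obtain ⟨η, hη, L, hL, κ₁, _hκ₁, εb, hεb, _hεb1, H⟩ := h R hR
  refine ⟨εb, hεb, fun ε₀ hε₀ hle α hα hK hKP => ?_⟩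
  -- the syntactic forward sources `S⁺(α)`: source-complete, and inside every source-complete set
  obtain ⟨Sp, hSp_complete, hSp_sub⟩ : ∃ Sp : Finset (Fin 4),
      (∀ i, i ∉ Sp → ∀ j l : Fin 4, α i j l (0, 0, 1) = 0) ∧
      (∀ S : Finset (Fin 4), (∀ i, i ∉ S → ∀ j l : Fin 4, α i j l (0, 0, 1) = 0) → Sp ⊆ S) := by
    refine ⟨Finset.univ.filter fun i : Fin 4 => ∃ j l : Fin 4, α i j l (0, 0, 1) ≠ 0, ?_, ?_⟩
    · intro i hi j l
      by_contra hne
      exact hi (Finset.mem_filter.2 ⟨Finset.mem_univ i, j, l, hne⟩)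
    · intro S hS i hi
      obtain ⟨-, j, l, hne⟩ := Finset.mem_filter.1 hi
      by_contra hiS
      exact hne (hS i hiS j l)
  refine ⟨Sp, hSp_complete, fun X₀ => ?_⟩
  -- the transient depth in shells
  obtain ⟨n₁, hn₁⟩ : ∃ n₁ : ℕ, κ₁ ≤ ε₀ * n₁ := by
    refine ⟨⌈κ₁ / ε₀⌉₊, ?_⟩
    have := Nat.le_ceil (κ₁ / ε₀)
    rwa [div_le_iff₀' hε₀] at this
  refine ⟨η, hη, fun T _hT =>
    ⟨(∑ i : Fin 4, (1 / 2 : ℝ) * X₀ i ^ 2) * (1 + ε₀) ^ ((1 + η) * ((n₁ + L : ℕ) : ℝ)),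
      fun ν hν s hs X hinit hlow hbd hcont hder n N _hnN t ht => ?_⟩⟩
  -- the ratchet's source set at this viscosity contains the syntactic sources
  obtain ⟨S, hS, HS⟩ := H ε₀ hε₀ hle ν hν α hα hK hKP
  have hsub : Sp ⊆ S := hSp_sub S hS
  obtain ⟨M, hM⟩ := hbd
  -- Kamke cone invariance: non-negative on shells `≥ 1`
  have hnonneg : ∀ t ∈ Set.Icc (0 : ℝ) s, ∀ (i : Fin 4) (k : ℤ), 1 ≤ k → 0 ≤ X i k t :=
    orthantInvariance_proof ε₀ ν hε₀ hν α hK X₀ s hs.1 X hinit hlow ⟨M, hM⟩ hcont hder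
  have hrat := HS X₀ s hs.1 X hinit hlow ⟨M, hM⟩ hcont hder hnonneg
  -- every forward-source tail is below the total energy, hence below `E₀`
  have hTle : ∀ (a : ℕ), ∀ u ∈ Icc (0 : ℝ) s,
      (∑' j : ℕ, ∑ i ∈ S, (1 / 2 : ℝ) * X i ((a : ℤ) + (j : ℤ)) u ^ 2) ≤
        ∑ i : Fin 4, (1 / 2 : ℝ) * X₀ i ^ 2 := by
    intro a u hu
    have hfull := orthantBreak_summable hε₀ hM a u
    have hs0 : Summable fun j : ℕ => ∑ i : Fin 4, (1 / 2 : ℝ) * X i (j : ℤ) u ^ 2 :=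
      (orthantBreak_summable hε₀ hM 0 u).congr fun j => by simp
    have hnn : ∀ j : ℕ, 0 ≤ ∑ i : Fin 4, (1 / 2 : ℝ) * X i (j : ℤ) u ^ 2 :=
      fun j => Finset.sum_nonneg fun i _ => by positivity
    calc (∑' j : ℕ, ∑ i ∈ S, (1 / 2 : ℝ) * X i ((a : ℤ) + (j : ℤ)) u ^ 2)
        ≤ ∑' j : ℕ, ∑ i : Fin 4, (1 / 2 : ℝ) * X i ((a : ℤ) + (j : ℤ)) u ^ 2 :=
          (forwardBreak_summable hε₀ S hM a u).tsum_le_tsum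
            (fun j => forwardBreak_sSum_le S X _ u) hfull
      _ = ∑' j : ℕ, ∑ i : Fin 4, (1 / 2 : ℝ) * X i ((a + j : ℕ) : ℤ) u ^ 2 := by
          simp only [Nat.cast_add]
      _ ≤ ∑' j : ℕ, ∑ i : Fin 4, (1 / 2 : ℝ) * X i (j : ℤ) u ^ 2 :=
          orthantBreak_tail_le hnn hs0 a
      _ ≤ ∑ i : Fin 4, (1 / 2 : ℝ) * X₀ i ^ 2 :=
          orthantBreak_energy_le hε₀ hν hα.2.1 hinit hlow hM hder hu
  -- the envelope for `S_ν`, then monotonicity down to the syntactic sources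
  have henv := forwardBreak_blockEnvelope hε₀ hL hn₁ S (forwardBreak_summable hε₀ S hM) hTle hrat
    hη n N ht
  calc ∑ k ∈ Finset.Icc n N, ∑ i ∈ Sp, (1 / 2 : ℝ) * X i (k : ℤ) t ^ 2
      ≤ ∑ k ∈ Finset.Icc n N, ∑ i ∈ S, (1 / 2 : ℝ) * X i (k : ℤ) t ^ 2 :=
        Finset.sum_le_sum fun k _ =>
          Finset.sum_le_sum_of_subset_of_nonneg hsub fun i _ _ => by positivity
    _ ≤ (∑ i : Fin 4, (1 / 2 : ℝ) * X₀ i ^ 2) * (1 + ε₀) ^ ((1 + η) * ((n₁ + L : ℕ) : ℝ)) *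
          (1 + ε₀) ^ (-((1 + η) * (n : ℝ))) := henv

/-- **Hence OW's block ratchet also closes SE's KP conjunct**: with `KPBlockWake`, the deciding
theorem `SubcriticalEnvelope.closes` needs only the proved smoothing and the two declared residuals.
Pure logic.  MODEL lattice statement; the rung is NOT closed here. [this file] -/
theorem subcriticalEnvelope_target_of_kpBlockWake (h : OrthantWake.KPBlockWake)
    (h5 : SubcriticalEnvelope.NonDiagonalOrthantBreak) (h4 : SubcriticalEnvelope.NonOrthantBreak) :
    Summit.NavierStokesRegularity.NavierStokesRegularity.Theses.TaoLadderRungTwoBreak.Target :=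
  SubcriticalEnvelope.closes (forwardSourceTailEnvelopeKP_of_kpBlockWake h)
    SubcriticalEnvelope.ForwardSourceSmoothing_holds h5 h4

end Summit.NavierStokesRegularity.NavierStokesRegularity.Theorems

end
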